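import Literature.MathematicalPhysics.QuantumFieldTheory.Balaban1983to89.B9Thm310CommutatorBound389BLoc
import Literature.MathematicalPhysics.QuantumFieldTheory.Balaban1983to89.B9Eq335CoveragePAtLettersY
import Literature.MathematicalPhysics.QuantumFieldTheory.Balaban1983to89.B11Eq135Weitzenbock

/-!
# `Balaban1983to89.B9Thm310CommutatorDataOfPlaquettes` — T. Bałaban, *Propagators for lattice gauge theories in a background field*, Commun. Math. Phys.
# **99** (1985) 389–434 [Balaban1985BackgroundPropagators], (3.35) p. 396 and (3.69) p. 404 («|Re U(∂p) − 1| ≤ …, |Im U(∂p)| ≤ … follow directly from the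
# assumptions (3.35)») feeding p. 414 («The operator K(h_□)G_□h_□ satisfies the inequality (3.89)»): **THE THREE SMALL HOLONOMY DATA OF THE BOND-SECTOR
# (3.89) READ OFF THE PLAQUETTE FIELDS** — E′₂b-loc's level-weighted hypotheses `hP` (plaquette-holonomy conjugation defect), `hKc` (conjugation defect of the
# Jordan insertion), `hI` (`c_f²·Im U(∂p)`), and `hRe`, DERIVED from ONE datum: bi-contractive bond variables with `|U(∂p) − 1| ≤ δ̂·L^{−2·lev(p₀)}` at every
# plaquette — and that datum itself derived, at the fibre `M_N(ℂ)`, from print's class (3.35) in def-Y's form `bg9KP.Reg335` (sub-row G-B9-LETTERS, module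
# M5.7-est, file E′₅; E′₁-loc ∕ E′₂b-loc ∕ E′₄-loc = `B9Eq3104CommutatorSizesLoc` ∕ `B9Thm310CommutatorBound389BLoc` ∕ `…LocOfInv`)

statement-level skeleton of published theorems with citation tags; proofs where landed; nothing here is a claim about the Yang–Mills mass gap

PDF held: `paper:balaban1985-cmp99-background-propagators` (journal page = PDF page + 388); pp. 390–392, 396, 404, 409, 414 read from the text layer.
p. 396 (3.35): «for an arbitrary cube □ of the described above class, and for a configuration U there exists a gauge transformation u on □ such that
U^u = e^{iηA}. and if the index of □ is j, then |A| < O(1)Mα₀(Lʲη)⁻¹, |∇^ηA| < O(1)Mα₀(Lʲη)⁻² on □»; p. 404: the estimates for `|Re U(∂p) − 1|`, `|Im U(∂p)|` «follow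
directly from the assumptions (3.35)»; p. 391 (3.7): `Re U(∂p)`, `Im U(∂p)`; p. 390 (3.1): `U(∂p)`.

## WHAT THIS FILE PROVES (THEOREMS only; 0 definitions, 0 `def … : Prop`, 0 sorry)
* §1 (any complete normed ℂ-algebra `𝔸`; bookkeeping of def-Y's letters): `UboxY_chartY`, ★ `plaqU_chartY_eq` (the abstract plaquette variable of
  `B9Eq39Adjoint.plaqU` on def-Y's box chart IS `U(∂p)`: `= holY` for `μ < λ`, `= holY⁻¹` for `λ < μ`, `= 1` for `μ = λ`), bi-contractivity of `U(∂p)` from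
  bi-contractive bond variables, `‖W⁻¹ − 1‖ ≤ ‖W⁻¹‖·‖W − 1‖` (`‖R(W)Y − Y‖ ≤ 2‖W − 1‖·‖Y‖` is the tree's `B11Eq135Weitzenbock.norm_R_sub_self_le`, used BY NAME), `‖Re U(∂p)‖ ≤ 1`, `‖Re U(∂p) − 1‖ ≤ ‖U(∂p) − 1‖`,
  `‖c_f²·Im U(∂p)‖ ≤ c_f²·‖U(∂p) − 1‖`, ★ `norm_jIns_conj_sub_le` (the conjugation defect of the Jordan insertion between neighbouring sites is at most
  `|c_f|·(‖Re U(∂p_w) − 1‖ + ‖Re U(∂p_x) − 1‖)`).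
* §2 ★★ THE FOUR DATA OF E′₂b-loc FROM ONE LEVEL-WEIGHTED PLAQUETTE DATUM `hW : ‖U(∂p) − 1‖ ≤ δ̂·(L^{lev p₀})⁻²` (all plaquettes `p`, `p₀` the corner) and
  bi-contractive `U`: `hP_of_plaquettes` (`δ_P = 2δ̂`), `hRe_of_bicontractive` (`ρ = 1`), `hKc_of_plaquettes` (`δ_K = δ̂·(L² + 1)`: one level step between `x − e_μ`
  and `x`, [4] (2.2)), `hI_of_plaquettes` (`δ_I = δ̂`) — in E′₂b-loc's LITERAL hypothesis shapes.
* §3 ★★★ `plaquetteDefect_of_reg335P` (fibre `M_N(ℂ)`, operator norm, `N ≥ 1`): for `U` in def-Y's PRINT class `(bg9KP (M_N(ℂ)) G i).Reg335 c α₀` (`c ≤ 10`,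
  `M·α₀ ≥ 0`) EVERY plaquette obeys `‖U(∂p) − 1‖ ≤ δ̂·(L^{lev p₀})⁻²` with `δ̂ = 2K(1+K)e^{4K}·L²`, `K = 10L·(M·α₀)` — the tree's per-cube estimate
  `B9Eq335PlaquetteAtLettersY.norm_holY_sub_one_le_of_reg335Cube` on the covering cube of `B9Eq335CoveragePAtLettersY.exists_cubeClassP_plaquette` (index
  `lev p₀` or `lev p₀ − 1`, whence the `L²`), i.e. `B9Eq335CoveragePAtLettersY.norm_holY_sub_one_le_of_reg335P` with the scale factor KEPT: print's
  «O(1)Mα₀(Lʲη)⁻²» of (3.69) in lattice units.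
* §4 ★★★ `norm_KhBY_O_hTY_apply_le_of_plaquettes` — E′₂b-loc's j-UNIFORM bond-sector (3.89) with the four data discharged from `hW`: constant
  `theta389B d ℓ B₀ b₁ δ 1 (2δ̂) (δ̂(L²+1)) δ̂ 0`, hypotheses = bi-contractive `U`, contractive averaging transporters, `hW`, the (3.42)₁,₂ entries of the letter `O`.
HONEST SCOPE.  Bookkeeping over def-Y's definitions + the tree's (3.35) plaquette estimate; bi-contractivity of the bond variables and of the averaging
transporters stays displayed (true for `G`-valued unitary `U`, discharged by the assembler as in M5.5); nothing of Thm 3.3 ∕ 3.10 asserted; nothing landed is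
modified; nothing continuum ∕ OS ∕ mass gap ∕ Clay; YM mass gap NOT proved by any of this (Track A conditional rung).  `--supports stmt-QuantumFields-19200`.
Net new unproved facts: 0.
-/

noncomputable section

namespace Literature.MathematicalPhysics.QuantumFieldTheory.Balaban1983to89.B9Thm310CommutatorDataOfPlaquettes

open Node00
open B9Thm37CubeCoverCommutators (cutMulY hTY)
open B9Thm37CommutatorBound389 (lev_le_succ_of_touch' torusSupNorm_sub_shiftY_le_one)
open B9Eq3104CutoffCommutators (hBdY KhBY)
open B9Thm310CommutatorBound389B (theta389B)
open B9Thm310CommutatorBound389BLoc (inv_pow_sq_le_of_le_succ norm_KhBY_O_hTY_apply_le_loc)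
open B6KLevelCensusIndexV1 (KIdx kGeo)
open B6Ineq2142KLevelV1 (β)
open B6GlobalChartV1 (PV blkV1 boxEquiv)
open B6Cover236MultiLevelBlocks (cubes)
open B9GeoNormsKLevelV1 (geo9K)
open Node00.OpsYNablaBridge (chartY shiftY_chartY)
open B9Eq39Adjoint (R R_def R_smul R_sub R_zero R_add plaqU)
open B9Eq310Hermitian (norm_R_le)
open B11Eq135Weitzenbock (norm_R_sub_self_le)
open B9Eq3104CommutatorSizesCurl (jIns)
open scoped Matrix

section General

variable {𝔸 : Type} [NormedRing 𝔸] [NormedAlgebra ℂ 𝔸] [CompleteSpace 𝔸]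
variable {d ℓ : ℕ} {hd : 1 ≤ d + 1} {hL : Odd (ℓ + 1) ∧ 1 < ℓ + 1} {b₀ b₁ : ℝ}
variable (i : KIdx d ℓ hd hL b₀ b₁)

/-! ## §1 def-Y's plaquette variable on the box chart; norms of `U(∂p)`, `Re U(∂p)`, `Im U(∂p)` and of the Jordan conjugation defect -/

/-- the transported background at a charted site is the background. [cite: Balaban1985BackgroundPropagators, (3.1) p.390, dictionary] -/
theorem UboxY_chartY (U : CfgY 𝔸 i) (μ : Fin (d + 1)) (x : Site (PV d ℓ i.m i.K hd hL) 0) : UboxY i U μ (chartY i x) = U μ x := by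
  show U μ ((boxEquiv i.hN).symm (boxEquiv i.hN x)) = U μ x
  rw [Equiv.symm_apply_apply]

/-- ★ the abstract plaquette variable of `B9Eq39Adjoint.plaqU` on def-Y's box chart, unfolded: `U_μ(x)U_λ(x+e_μ)U_μ(x+e_λ)⁻¹U_λ(x)⁻¹`.
[cite: Balaban1985BackgroundPropagators, (3.1) p.390] -/
theorem plaqU_chartY_eq (U : CfgY 𝔸 i) (μ lam : Fin (d + 1)) (x : Site (PV d ℓ i.m i.K hd hL) 0) :
    plaqU (shiftY i) (UboxY i U) μ lam (chartY i x) = U μ x * U lam (x.shift μ) * (U μ (x.shift lam))⁻¹ * (U lam x)⁻¹ := by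
  unfold plaqU
  rw [shiftY_chartY, shiftY_chartY, UboxY_chartY, UboxY_chartY, UboxY_chartY, UboxY_chartY]

/-- for `μ < λ` it is `U(∂p)`, `p = p_{μλ}(x)`. [cite: Balaban1985BackgroundPropagators, (3.1) p.390] -/
theorem plaqU_chartY_of_lt (U : CfgY 𝔸 i) {μ lam : Fin (d + 1)} (h : μ < lam) (x : Site (PV d ℓ i.m i.K hd hL) 0) :
    plaqU (shiftY i) (UboxY i U) μ lam (chartY i x) = holY i U ⟨x, μ, lam, h⟩ := by
  rw [plaqU_chartY_eq]; rfl

/-- for `λ < μ` it is `U(∂p)⁻¹ = U(−∂p)`, `p = p_{λμ}(x)`. [cite: Balaban1985BackgroundPropagators, (3.1) p.390, (3.7) p.391 («U(−∂p)»)] -/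
theorem plaqU_chartY_of_gt (U : CfgY 𝔸 i) {μ lam : Fin (d + 1)} (h : lam < μ) (x : Site (PV d ℓ i.m i.K hd hL) 0) :
    plaqU (shiftY i) (UboxY i U) μ lam (chartY i x) = (holY i U ⟨x, lam, μ, h⟩)⁻¹ := by
  rw [plaqU_chartY_eq]
  show _ = (U lam x * U μ (x.shift lam) * (U lam (x.shift μ))⁻¹ * (U μ x)⁻¹)⁻¹
  simp only [mul_inv_rev, inv_inv, mul_assoc]

/-- for `μ = λ` it is `1`. [cite: Balaban1985BackgroundPropagators, (3.1) p.390, bookkeeping] -/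
theorem plaqU_chartY_self (U : CfgY 𝔸 i) (μ : Fin (d + 1)) (x : Site (PV d ℓ i.m i.K hd hL) 0) :
    plaqU (shiftY i) (UboxY i U) μ μ (chartY i x) = 1 := by
  rw [plaqU_chartY_eq, mul_inv_cancel_right, mul_inv_cancel]

omit [NormedAlgebra ℂ 𝔸] [CompleteSpace 𝔸] in
/-- products of bi-contractive units are bi-contractive. [cite: Balaban1985BackgroundPropagators, (3.1) p.390, bookkeeping] -/
theorem bicontr_mul {u v : 𝔸ˣ} (hu : ‖(u : 𝔸)‖ ≤ 1 ∧ ‖((u⁻¹ : 𝔸ˣ) : 𝔸)‖ ≤ 1) (hv : ‖(v : 𝔸)‖ ≤ 1 ∧ ‖((v⁻¹ : 𝔸ˣ) : 𝔸)‖ ≤ 1) :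
    ‖((u * v : 𝔸ˣ) : 𝔸)‖ ≤ 1 ∧ ‖(((u * v)⁻¹ : 𝔸ˣ) : 𝔸)‖ ≤ 1 := by
  constructor
  · rw [Units.val_mul]
    exact (norm_mul_le _ _).trans (mul_le_one₀ hu.1 (norm_nonneg _) hv.1)
  · rw [mul_inv_rev, Units.val_mul]
    exact (norm_mul_le _ _).trans (mul_le_one₀ hv.2 (norm_nonneg _) hu.2)

omit [NormedAlgebra ℂ 𝔸] [CompleteSpace 𝔸] in
/-- inverses of bi-contractive units are bi-contractive. [cite: Balaban1985BackgroundPropagators, (3.5) p.391, bookkeeping] -/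
theorem bicontr_inv {u : 𝔸ˣ} (hu : ‖(u : 𝔸)‖ ≤ 1 ∧ ‖((u⁻¹ : 𝔸ˣ) : 𝔸)‖ ≤ 1) :
    ‖((u⁻¹ : 𝔸ˣ) : 𝔸)‖ ≤ 1 ∧ ‖(((u⁻¹)⁻¹ : 𝔸ˣ) : 𝔸)‖ ≤ 1 := by
  rw [inv_inv]; exact ⟨hu.2, hu.1⟩

/-- `U(∂p)` is bi-contractive when the bond variables are. [cite: Balaban1985BackgroundPropagators, (3.1) p.390] -/
theorem bicontr_holY (U : CfgY 𝔸 i) (hU : ∀ μ x, ‖(U μ x : 𝔸)‖ ≤ 1 ∧ ‖(((U μ x)⁻¹ : 𝔸ˣ) : 𝔸)‖ ≤ 1) (p : PlaqY i) :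
    ‖((holY i U p : 𝔸ˣ) : 𝔸)‖ ≤ 1 ∧ ‖(((holY i U p)⁻¹ : 𝔸ˣ) : 𝔸)‖ ≤ 1 := by
  unfold holY
  exact bicontr_mul (bicontr_mul (bicontr_mul (hU _ _) (hU _ _)) (bicontr_inv (hU _ _))) (bicontr_inv (hU _ _))

/-- the abstract plaquette variable on the chart is bi-contractive when the bond variables are. [cite: Balaban1985BackgroundPropagators, (3.1) p.390] -/
theorem bicontr_plaqU (U : CfgY 𝔸 i) (hU : ∀ μ x, ‖(U μ x : 𝔸)‖ ≤ 1 ∧ ‖(((U μ x)⁻¹ : 𝔸ˣ) : 𝔸)‖ ≤ 1) (μ lam : Fin (d + 1)) (w : SiteY i) :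
    ‖((plaqU (shiftY i) (UboxY i U) μ lam w : 𝔸ˣ) : 𝔸)‖ ≤ 1 ∧ ‖(((plaqU (shiftY i) (UboxY i U) μ lam w)⁻¹ : 𝔸ˣ) : 𝔸)‖ ≤ 1 := by
  have hUb : ∀ μ (z : SiteY i), ‖(UboxY i U μ z : 𝔸)‖ ≤ 1 ∧ ‖(((UboxY i U μ z)⁻¹ : 𝔸ˣ) : 𝔸)‖ ≤ 1 := fun μ z => hU μ _
  unfold plaqU
  exact bicontr_mul (bicontr_mul (bicontr_mul (hUb _ _) (hUb _ _)) (bicontr_inv (hUb _ _))) (bicontr_inv (hUb _ _))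

omit [NormedAlgebra ℂ 𝔸] [CompleteSpace 𝔸] in
/-- `‖W⁻¹ − 1‖ ≤ ‖W⁻¹‖·‖W − 1‖` (`W⁻¹ − 1 = W⁻¹(1 − W)`); with `‖W⁻¹‖ ≤ 1` this is `‖U(−∂p) − 1‖ ≤ ‖U(∂p) − 1‖`.
[cite: Balaban1985BackgroundPropagators, (3.7) p.391 («U(−∂p)»), bookkeeping] -/
theorem norm_inv_sub_one_le_mul (W : 𝔸ˣ) : ‖((W⁻¹ : 𝔸ˣ) : 𝔸) - 1‖ ≤ ‖((W⁻¹ : 𝔸ˣ) : 𝔸)‖ * ‖(W : 𝔸) - 1‖ := by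
  have e : ((W⁻¹ : 𝔸ˣ) : 𝔸) - 1 = ((W⁻¹ : 𝔸ˣ) : 𝔸) * (1 - (W : 𝔸)) := by rw [mul_sub, mul_one, Units.inv_mul]
  rw [e, ← norm_sub_rev (1 : 𝔸) (W : 𝔸)]
  exact norm_mul_le _ _

omit [NormedAlgebra ℂ 𝔸] [CompleteSpace 𝔸] in
/-- hence `‖W⁻¹ − 1‖ ≤ ‖W − 1‖` for a bi-contractive `W`. [cite: Balaban1985BackgroundPropagators, (3.7) p.391 («U(−∂p)»), bookkeeping] -/
theorem norm_inv_sub_one_le_of_bicontr {W : 𝔸ˣ} (h : ‖(W : 𝔸)‖ ≤ 1 ∧ ‖((W⁻¹ : 𝔸ˣ) : 𝔸)‖ ≤ 1) :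
    ‖((W⁻¹ : 𝔸ˣ) : 𝔸) - 1‖ ≤ ‖(W : 𝔸) - 1‖ :=
  (norm_inv_sub_one_le_mul W).trans ((mul_le_mul_of_nonneg_right h.2 (norm_nonneg _)).trans (le_of_eq (one_mul _)))

/-- `‖Re U(∂p)‖ ≤ 1` for bi-contractive `U(∂p)`. [cite: Balaban1985BackgroundPropagators, (3.7) p.391] -/
theorem norm_reHolY_le_one (U : CfgY 𝔸 i) (p : PlaqY i) (h : ‖((holY i U p : 𝔸ˣ) : 𝔸)‖ ≤ 1 ∧ ‖(((holY i U p)⁻¹ : 𝔸ˣ) : 𝔸)‖ ≤ 1) :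
    ‖reHolY i U p‖ ≤ 1 := by
  unfold reHolY
  rw [norm_smul]
  have hn : ‖(1 / 2 : ℂ)‖ = 1 / 2 := by norm_num
  rw [hn]
  have := norm_add_le ((holY i U p : 𝔸ˣ) : 𝔸) (((holY i U p)⁻¹ : 𝔸ˣ) : 𝔸)
  linarith [h.1, h.2]

/-- `‖Re U(∂p) − 1‖ ≤ ‖U(∂p) − 1‖` for bi-contractive `U(∂p)` (`Re W − 1 = ½((W − 1) + (W⁻¹ − 1))`). [cite: Balaban1985BackgroundPropagators, (3.7) p.391, (3.69) p.404] -/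
theorem norm_reHolY_sub_one_le (U : CfgY 𝔸 i) (p : PlaqY i) (h : ‖((holY i U p : 𝔸ˣ) : 𝔸)‖ ≤ 1 ∧ ‖(((holY i U p)⁻¹ : 𝔸ˣ) : 𝔸)‖ ≤ 1) :
    ‖reHolY i U p - 1‖ ≤ ‖((holY i U p : 𝔸ˣ) : 𝔸) - 1‖ := by
  have e : reHolY i U p - 1 = (1 / 2 : ℂ) • ((((holY i U p : 𝔸ˣ) : 𝔸) - 1) + ((((holY i U p)⁻¹ : 𝔸ˣ) : 𝔸) - 1)) := by
    unfold reHolY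
    rw [show (((holY i U p : 𝔸ˣ) : 𝔸) - 1) + ((((holY i U p)⁻¹ : 𝔸ˣ) : 𝔸) - 1)
        = (((holY i U p : 𝔸ˣ) : 𝔸) + (((holY i U p)⁻¹ : 𝔸ˣ) : 𝔸)) - (2 : ℂ) • (1 : 𝔸) by rw [two_smul]; abel,
      smul_sub, smul_smul]
    norm_num
  rw [e, norm_smul]
  have hn : ‖(1 / 2 : ℂ)‖ = 1 / 2 := by norm_num
  rw [hn]
  have := norm_add_le (((holY i U p : 𝔸ˣ) : 𝔸) - 1) ((((holY i U p)⁻¹ : 𝔸ˣ) : 𝔸) - 1)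
  have := norm_inv_sub_one_le_of_bicontr h
  linarith

/-- `‖c_f²·Im U(∂p)‖ ≤ c_f²·‖U(∂p) − 1‖` for bi-contractive `U(∂p)` (`Im W = (1∕2i)((W − 1) − (W⁻¹ − 1))`).
[cite: Balaban1985BackgroundPropagators, (3.7) p.391, (3.10) p.392, (3.69) p.404] -/
theorem norm_cfsq_imHolY_le (U : CfgY 𝔸 i) (p : PlaqY i) (h : ‖((holY i U p : 𝔸ˣ) : 𝔸)‖ ≤ 1 ∧ ‖(((holY i U p)⁻¹ : 𝔸ˣ) : 𝔸)‖ ≤ 1) :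
    ‖((i.cf ^ 2 : ℝ) : ℂ) • imHolY i U p‖ ≤ i.cf ^ 2 * ‖((holY i U p : 𝔸ˣ) : 𝔸) - 1‖ := by
  have e : imHolY i U p = (-Complex.I / 2) • ((((holY i U p : 𝔸ˣ) : 𝔸) - 1) - ((((holY i U p)⁻¹ : 𝔸ˣ) : 𝔸) - 1)) := by
    unfold imHolY; congr 1; abel
  rw [norm_smul, Complex.norm_real, Real.norm_eq_abs, abs_of_nonneg (sq_nonneg _), e, norm_smul]
  have hn : ‖(-Complex.I / 2 : ℂ)‖ = 1 / 2 := by simp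
  rw [hn]
  refine mul_le_mul_of_nonneg_left ?_ (sq_nonneg _)
  have := norm_sub_le (((holY i U p : 𝔸ˣ) : 𝔸) - 1) ((((holY i U p)⁻¹ : 𝔸ˣ) : 𝔸) - 1)
  have := norm_inv_sub_one_le_of_bicontr h
  linarith

omit [NormedAlgebra ℂ 𝔸] [CompleteSpace 𝔸] in
/-- conjugating a sandwich: `a′(aZa′·X + X·aZa′)a = Z·(a′Xa) + (a′Xa)·Z` when `a′a = 1`. [cite: Balaban1985BackgroundPropagators, (3.10) p.392, bookkeeping] -/
theorem conj_sandwich_eq {a a' Z X : 𝔸} (h : a' * a = 1) :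
    a' * (a * Z * a' * X + X * (a * Z * a')) * a = Z * (a' * X * a) + (a' * X * a) * Z := by
  calc a' * (a * Z * a' * X + X * (a * Z * a')) * a = (a' * a) * Z * (a' * X * a) + (a' * X * a) * Z * (a' * a) := by noncomm_ring
    _ = Z * (a' * X * a) + (a' * X * a) * Z := by rw [h]; noncomm_ring

/-- ★ **THE CONJUGATION DEFECT OF THE JORDAN INSERTION BETWEEN NEIGHBOURING SITES**: for a bi-contractive unit `u` (the bond variable `U_μ(w)`,
`w = x − e_μ`), `‖R(u)⁻¹𝒦_{ae,w}(R(u)Z) − 𝒦_{ae,x}Z‖ ≤ |c_f|·(‖Re U(∂p_{ae}(w)) − 1‖ + ‖Re U(∂p_{ae}(x)) − 1‖)·‖Z‖` (`𝒦 = jIns U`, zero unless `a < e`).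
[cite: Balaban1985BackgroundPropagators, (3.10) p.392, (3.7) p.391, p.414 l.1–3] -/
theorem norm_jIns_conj_sub_le (U : CfgY 𝔸 i) (u : 𝔸ˣ) (hu : ‖(u : 𝔸)‖ ≤ 1 ∧ ‖((u⁻¹ : 𝔸ˣ) : 𝔸)‖ ≤ 1) (a e : Fin (d + 1))
    (w x : SiteY i) (Z : 𝔸) {Bw Bx : ℝ}
    (hw : ∀ hae : a < e, ‖reHolY i U ⟨(chartY i).symm w, a, e, hae⟩ - 1‖ ≤ Bw)
    (hx : ∀ hae : a < e, ‖reHolY i U ⟨(chartY i).symm x, a, e, hae⟩ - 1‖ ≤ Bx) (hBw : 0 ≤ Bw) (hBx : 0 ≤ Bx) :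
    ‖R u⁻¹ (jIns i U a e w (R u Z)) - jIns i U a e x Z‖ ≤ |i.cf| * (Bw + Bx) * ‖Z‖ := by
  unfold jIns
  split_ifs with hae
  · set Xw := reHolY i U ⟨(chartY i).symm w, a, e, hae⟩ with hXw
    set Xx := reHolY i U ⟨(chartY i).symm x, a, e, hae⟩ with hXx
    set D : 𝔸 := ((u⁻¹ : 𝔸ˣ) : 𝔸) * Xw * (u : 𝔸) - Xx with hD
    have hua : ((u⁻¹ : 𝔸ˣ) : 𝔸) * (u : 𝔸) = 1 := Units.inv_mul u
    -- the algebra: the difference is the insertion of `D`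
    have e1 : R u⁻¹ ((((i.cf : ℝ) : ℂ) • ((1 / 2 : ℂ) • (LinearMap.mulRight ℂ Xw + LinearMap.mulLeft ℂ Xw))) (R u Z))
        - (((i.cf : ℝ) : ℂ) • ((1 / 2 : ℂ) • (LinearMap.mulRight ℂ Xx + LinearMap.mulLeft ℂ Xx))) Z
        = ((i.cf : ℝ) : ℂ) • ((1 / 2 : ℂ) • (Z * D + D * Z)) := by
      simp only [LinearMap.smul_apply, LinearMap.add_apply, LinearMap.mulRight_apply, LinearMap.mulLeft_apply, R_smul]
      rw [R_def, R_def, inv_inv, conj_sandwich_eq hua, hD, ← smul_sub, ← smul_sub]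
      congr 2
      noncomm_ring
    rw [e1, norm_smul, norm_smul, Complex.norm_real, Real.norm_eq_abs]
    have hn : ‖(1 / 2 : ℂ)‖ = 1 / 2 := by norm_num
    rw [hn]
    -- the size of `D`
    have hDle : ‖D‖ ≤ Bw + Bx := by
      have eD : D = ((u⁻¹ : 𝔸ˣ) : 𝔸) * (Xw - 1) * (u : 𝔸) + (1 - Xx) := by
        rw [hD, mul_sub, sub_mul, mul_one, hua]; abel
      rw [eD]
      have t1 : ‖((u⁻¹ : 𝔸ˣ) : 𝔸) * (Xw - 1) * (u : 𝔸)‖ ≤ Bw := by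
        calc ‖((u⁻¹ : 𝔸ˣ) : 𝔸) * (Xw - 1) * (u : 𝔸)‖ ≤ ‖((u⁻¹ : 𝔸ˣ) : 𝔸)‖ * ‖Xw - 1‖ * ‖(u : 𝔸)‖ :=
              (norm_mul_le _ _).trans (mul_le_mul_of_nonneg_right (norm_mul_le _ _) (norm_nonneg _))
          _ ≤ 1 * Bw * 1 := by gcongr; exacts [hu.2, hw hae, hu.1]
          _ = Bw := by ring
      have t2 : ‖(1 : 𝔸) - Xx‖ ≤ Bx := by rw [norm_sub_rev]; exact hx hae
      exact (norm_add_le _ _).trans (add_le_add t1 t2)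
    have hZD : ‖Z * D + D * Z‖ ≤ 2 * (Bw + Bx) * ‖Z‖ := by
      have := norm_add_le (Z * D) (D * Z)
      have := norm_mul_le Z D
      have := norm_mul_le D Z
      have : ‖Z‖ * ‖D‖ ≤ ‖Z‖ * (Bw + Bx) := mul_le_mul_of_nonneg_left hDle (norm_nonneg _)
      nlinarith [norm_nonneg Z, norm_nonneg D]
    calc |i.cf| * (1 / 2 * ‖Z * D + D * Z‖) ≤ |i.cf| * (1 / 2 * (2 * (Bw + Bx) * ‖Z‖)) := by gcongr
      _ = |i.cf| * (Bw + Bx) * ‖Z‖ := by ring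
  · rw [LinearMap.zero_apply, LinearMap.zero_apply, R_zero, sub_zero, norm_zero]; positivity

/-! ## §2 E′₂b-loc's four data from ONE level-weighted plaquette datum -/

/-- ★★ **`hP` FROM THE PLAQUETTES** (`δ_P = 2δ̂`): bi-contractive bond variables with `‖U(∂p) − 1‖ ≤ δ̂·(L^{lev p₀})⁻²` at every plaquette give
`‖R(U(∂p_{μλ}(w)))Y − Y‖ ≤ 2δ̂·(L^{lev w})⁻²·‖Y‖` for all `μ, λ, w` (the plaquette variable is `U(∂p)`, `U(∂p)⁻¹` or `1`).
[cite: Balaban1985BackgroundPropagators, (3.35) p.396, (3.69) p.404, (3.1) p.390] -/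
theorem hP_of_plaquettes (U : CfgY 𝔸 i) (hU : ∀ μ x, ‖(U μ x : 𝔸)‖ ≤ 1 ∧ ‖(((U μ x)⁻¹ : 𝔸ˣ) : 𝔸)‖ ≤ 1) {δh : ℝ} (hδh : 0 ≤ δh)
    (hW : ∀ p : PlaqY i, ‖((holY i U p : 𝔸ˣ) : 𝔸) - 1‖ ≤ δh * ((((ℓ : ℝ) + 1) ^ levY i (chartY i p.src))⁻¹) ^ 2)
    (μ lam : Fin (d + 1)) (w : SiteY i) (Y : 𝔸) :
    ‖R (plaqU (shiftY i) (UboxY i U) μ lam w) Y - Y‖ ≤ 2 * δh * ((((ℓ : ℝ) + 1) ^ levY i w)⁻¹) ^ 2 * ‖Y‖ := by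
  have hb := bicontr_plaqU i U hU μ lam w
  refine (norm_R_sub_self_le hb.2 Y).trans ?_
  have hw : chartY i ((chartY i).symm w) = w := Equiv.apply_symm_apply _ _
  have key : ‖((plaqU (shiftY i) (UboxY i U) μ lam w : 𝔸ˣ) : 𝔸) - 1‖ ≤ δh * ((((ℓ : ℝ) + 1) ^ levY i w)⁻¹) ^ 2 := by
    rcases lt_trichotomy μ lam with h | h | h
    · have e := plaqU_chartY_of_lt i U h ((chartY i).symm w)
      rw [hw] at e
      rw [e]
      have := hW ⟨(chartY i).symm w, μ, lam, h⟩
      rwa [hw] at this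
    · subst h
      have e := plaqU_chartY_self i U μ ((chartY i).symm w)
      rw [hw] at e
      rw [e, Units.val_one, sub_self, norm_zero]; positivity
    · have e := plaqU_chartY_of_gt i U h ((chartY i).symm w)
      rw [hw] at e
      rw [e]
      have hp := hW ⟨(chartY i).symm w, lam, μ, h⟩
      rw [hw] at hp
      exact (norm_inv_sub_one_le_of_bicontr (bicontr_holY i U hU _)).trans hp
  have := mul_le_mul_of_nonneg_right (mul_le_mul_of_nonneg_left key (by norm_num : (0 : ℝ) ≤ 2)) (norm_nonneg Y)
  linarith [this]

/-- ★ **`hRe` FROM BI-CONTRACTIVITY** (`ρ = 1`). [cite: Balaban1985BackgroundPropagators, (3.7) p.391] -/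
theorem hRe_of_bicontractive (U : CfgY 𝔸 i) (hU : ∀ μ x, ‖(U μ x : 𝔸)‖ ≤ 1 ∧ ‖(((U μ x)⁻¹ : 𝔸ˣ) : 𝔸)‖ ≤ 1) (p : PlaqY i) :
    ‖reHolY i U p‖ ≤ 1 :=
  norm_reHolY_le_one i U p (bicontr_holY i U hU p)

/-- ★★ **`hI` FROM THE PLAQUETTES** (`δ_I = δ̂`): `‖c_f²·Im U(∂p)‖ ≤ δ̂·c_f²·(L^{lev p₀})⁻²`. [cite: Balaban1985BackgroundPropagators, (3.10) p.392, (3.69) p.404, (3.35) p.396] -/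
theorem hI_of_plaquettes (U : CfgY 𝔸 i) (hU : ∀ μ x, ‖(U μ x : 𝔸)‖ ≤ 1 ∧ ‖(((U μ x)⁻¹ : 𝔸ˣ) : 𝔸)‖ ≤ 1) {δh : ℝ}
    (hW : ∀ p : PlaqY i, ‖((holY i U p : 𝔸ˣ) : 𝔸) - 1‖ ≤ δh * ((((ℓ : ℝ) + 1) ^ levY i (chartY i p.src))⁻¹) ^ 2) (p : PlaqY i) :
    ‖((i.cf ^ 2 : ℝ) : ℂ) • imHolY i U p‖ ≤ δh * i.cf ^ 2 * ((((ℓ : ℝ) + 1) ^ levY i (chartY i p.src))⁻¹) ^ 2 := by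
  refine (norm_cfsq_imHolY_le i U p (bicontr_holY i U hU p)).trans ?_
  have := mul_le_mul_of_nonneg_left (hW p) (sq_nonneg i.cf)
  linarith [this]

/-- ★★ **`hKc` FROM THE PLAQUETTES** (`δ_K = δ̂·(L² + 1)`): the conjugation defect of the Jordan insertion between `x − e_μ` and `x` is at most
`δ̂(L² + 1)·|c_f|·(L^{lev x})⁻²·‖Z‖` — the plaquette at `x − e_μ` sits at most one level below `x` ([4] (2.2)), which costs `L²`.
[cite: Balaban1985BackgroundPropagators, (3.10) p.392, (3.69) p.404, (3.35) p.396; Balaban1984PropagatorsII, (2.2) p.224] -/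
theorem hKc_of_plaquettes (U : CfgY 𝔸 i) (hU : ∀ μ x, ‖(U μ x : 𝔸)‖ ≤ 1 ∧ ‖(((U μ x)⁻¹ : 𝔸ˣ) : 𝔸)‖ ≤ 1) {δh : ℝ} (hδh : 0 ≤ δh)
    (hW : ∀ p : PlaqY i, ‖((holY i U p : 𝔸ˣ) : 𝔸) - 1‖ ≤ δh * ((((ℓ : ℝ) + 1) ^ levY i (chartY i p.src))⁻¹) ^ 2)
    (a e μ : Fin (d + 1)) (x : SiteY i) (Z : 𝔸) :
    ‖R (UboxY i U μ ((shiftY i μ).symm x))⁻¹ (jIns i U a e ((shiftY i μ).symm x) (R (UboxY i U μ ((shiftY i μ).symm x)) Z)) - jIns i U a e x Z‖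
      ≤ δh * (((ℓ : ℝ) + 1) ^ 2 + 1) * |i.cf| * ((((ℓ : ℝ) + 1) ^ levY i x)⁻¹) ^ 2 * ‖Z‖ := by
  have hL1 : (1 : ℝ) ≤ (ℓ : ℝ) + 1 := by linarith [(Nat.cast_nonneg ℓ : (0 : ℝ) ≤ ℓ)]
  set w : SiteY i := (shiftY i μ).symm x with hwdef
  set wt : ℝ := ((((ℓ : ℝ) + 1) ^ levY i x)⁻¹) ^ 2 with hwtdef
  have hwt0 : 0 ≤ wt := by positivity
  -- one level step between `w = x − e_μ` and `x`
  have hlev : levY i x ≤ levY i w + 1 := lev_le_succ_of_touch' i (torusSupNorm_sub_shiftY_le_one i μ x).2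
  have hww : ((((ℓ : ℝ) + 1) ^ levY i w)⁻¹) ^ 2 ≤ ((ℓ : ℝ) + 1) ^ 2 * wt := inv_pow_sq_le_of_le_succ hL1 hlev
  have hcw : chartY i ((chartY i).symm w) = w := Equiv.apply_symm_apply _ _
  have hcx : chartY i ((chartY i).symm x) = x := Equiv.apply_symm_apply _ _
  have hBw : ∀ hae : a < e, ‖reHolY i U ⟨(chartY i).symm w, a, e, hae⟩ - 1‖ ≤ δh * (((ℓ : ℝ) + 1) ^ 2 * wt) := by
    intro hae
    refine (norm_reHolY_sub_one_le i U _ (bicontr_holY i U hU _)).trans ?_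
    have h := hW ⟨(chartY i).symm w, a, e, hae⟩
    rw [show (⟨(chartY i).symm w, a, e, hae⟩ : PlaqY i).src = (chartY i).symm w from rfl, hcw] at h
    exact h.trans (mul_le_mul_of_nonneg_left hww hδh)
  have hBx : ∀ hae : a < e, ‖reHolY i U ⟨(chartY i).symm x, a, e, hae⟩ - 1‖ ≤ δh * wt := by
    intro hae
    refine (norm_reHolY_sub_one_le i U _ (bicontr_holY i U hU _)).trans ?_
    have h := hW ⟨(chartY i).symm x, a, e, hae⟩
    rw [show (⟨(chartY i).symm x, a, e, hae⟩ : PlaqY i).src = (chartY i).symm x from rfl, hcx] at h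
    exact h
  have hu : ‖(UboxY i U μ w : 𝔸)‖ ≤ 1 ∧ ‖(((UboxY i U μ w)⁻¹ : 𝔸ˣ) : 𝔸)‖ ≤ 1 := hU μ _
  have key := norm_jIns_conj_sub_le i U (UboxY i U μ w) hu a e w x Z hBw hBx (by positivity) (by positivity)
  refine key.trans (le_of_eq ?_)
  ring

/-! ## §4 The bond-sector (3.89), j-uniform, its holonomy data discharged from the plaquettes -/

/-- ★★★ **THE BOND-SECTOR (3.89) POINTWISE, j-UNIFORM, FROM THE PLAQUETTE FIELDS** — E′₂b-loc's `norm_KhBY_O_hTY_apply_le_loc` with its four holonomy data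
READ OFF one level-weighted plaquette datum `‖U(∂p) − 1‖ ≤ δ̂·(L^{lev p₀})⁻²` (§2): for any bond cube letter `O` with the (3.42)₁,₂ entries `(B₀, δ)`, bi-contractive
bond variables and averaging transporters, a corner-free member with `η = |c_f|⁻¹`,
`‖(K(h_□)(U)(O(h_□Λ)))(b)‖ ≤ θ₃₈₉ᴮ(d, L, B₀, b₁, δ, 1, 2δ̂, δ̂(L²+1), δ̂; 0)∕(L·M_h)·e^{−δd(y,y′)}·|J|` — print's «K(h_□)G_□h_□ satisfies the inequality (3.89)»
with «O(M⁻¹)» = `θ∕(L·M_h)`, `θ` depending on `d, L, B₀, b₁, δ, δ̂` only.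
[cite: Balaban1985BackgroundPropagators, p.414, (3.89) p.409, Thm 3.3 p.399, (3.35) p.396, (3.69) p.404; Balaban1984PropagatorsII, (2.43)–(2.44) p.230] -/
theorem norm_KhBY_O_hTY_apply_le_of_plaquettes (c : ↥(cubes i.D.toDomains)) (parB : BondParY 𝔸 i) (U : CfgY 𝔸 i)
    (O : (FBondY i → 𝔸) →ₗ[ℂ] (FBondY i → 𝔸)) {B₀ δ : ℝ} (hB₀ : 0 ≤ B₀) (hδ : 0 ≤ δ)
    (hη : etaS i = |i.cf|⁻¹) (ιB : BlkY i → IBondY i) (hι : ∀ s, β i.hN i.D i.hk (ιB s) = s)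
    (hU : ∀ μ x, ‖(U μ x : 𝔸)‖ ≤ 1 ∧ ‖(((U μ x)⁻¹ : 𝔸ˣ) : 𝔸)‖ ≤ 1)
    (hT : ∀ (y : IBondY i) (f : FBondY i), ‖(qT i parB U y f : 𝔸)‖ ≤ 1 ∧ ‖(((qT i parB U y f)⁻¹ : 𝔸ˣ) : 𝔸)‖ ≤ 1)
    {δh : ℝ} (hδh : 0 ≤ δh)
    (hW : ∀ p : PlaqY i, ‖((holY i U p : 𝔸ˣ) : 𝔸) - 1‖ ≤ δh * ((((ℓ : ℝ) + 1) ^ levY i (chartY i p.src))⁻¹) ^ 2)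
    (h342₀ : ∀ (J : FBondY i → ℝ) (y y' : IBondY i), (geo9K i).suppIn (Sum.inr J) y' →
      ∀ Λ : FBondY i → 𝔸, (∀ x, ‖Λ x‖ ≤ |J x|) → ∀ x : FBondY i, blkV1 i.hN i.D x = β i.hN i.D i.hk y →
        ‖O Λ x‖ ≤ B₀ * (geo9K i).len y ^ 2 * Real.exp (-(δ * (geo9K i).dist y y')) * (geo9K i).supNorm (Sum.inr J))
    (h342₁ : ∀ (J : FBondY i → ℝ) (y y' : IBondY i), (geo9K i).suppIn (Sum.inr J) y' →
      ∀ Λ : FBondY i → 𝔸, (∀ x, ‖Λ x‖ ≤ |J x|) → ∀ (x : FBondY i) (ν : Fin (d + 1)), blkV1 i.hN i.D x = β i.hN i.D i.hk y →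
        ‖cdB i U ν (O Λ) x‖ ≤ B₀ * (geo9K i).len y * Real.exp (-(δ * (geo9K i).dist y y')) * (geo9K i).supNorm (Sum.inr J))
    (J : FBondY i → ℝ) (y y' : IBondY i) (hs : (geo9K i).suppIn (Sum.inr J) y')
    (Λ : FBondY i → 𝔸) (hΛ : ∀ x, ‖Λ x‖ ≤ |J x|) (b : FBondY i) (hb : blkV1 i.hN i.D b = β i.hN i.D i.hk y) :
    ‖KhBY i (hTY i c) parB U (O (cutMulY (hBdY i (hTY i c)) Λ)) b‖
      ≤ theta389B d ℓ B₀ b₁ δ 1 (2 * δh) (δh * (((ℓ : ℝ) + 1) ^ 2 + 1)) δh 0 / (((ℓ : ℝ) + 1) * i.Mh) * Real.exp (-(δ * (geo9K i).dist y y'))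
          * (geo9K i).supNorm (Sum.inr J) :=
  norm_KhBY_O_hTY_apply_le_loc i c parB U O hB₀ hδ hη ιB hι hU hT (by positivity) zero_le_one (by positivity) hδh
    (hP_of_plaquettes i U hU hδh hW) (hRe_of_bicontractive i U hU) (hKc_of_plaquettes i U hU hδh hW) (hI_of_plaquettes i U hU hW)
    h342₀ h342₁ J y y' hs Λ hΛ b hb

end General

/-! ## §3 The plaquette datum from print's class (3.35) at the fibre `M_N(ℂ)` -/

section Reg335

open scoped Matrix.Norms.L2Operator
open B9BackgroundsKLevelV1 B9BackgroundsKLevelV1P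
open B9Eq335PlaquetteAtLettersY (norm_holY_sub_one_le_of_reg335Cube eta_pos one_le_L)
open B9Eq335CoveragePAtLettersY (exists_cubeClassP_plaquette plaqBound_mono)

variable {d ℓ : ℕ} {hd : 1 ≤ d + 1} {hL : Odd (ℓ + 1) ∧ 1 < ℓ + 1} {b₀ b₁ : ℝ} {N : ℕ}
variable (i : KIdx d ℓ hd hL b₀ b₁)

/-- the level of def-Y's box chart is the level of the site. [cite: Balaban1984PropagatorsII, (2.3)–(2.4) p.224, dictionary] -/
theorem levY_chartY (x : Site (PV d ℓ i.m i.K hd hL) 0) : levY i (chartY i x) = levV1 i x := rfl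

/-- ★★★ **PRINT'S (3.35) BOUNDS EVERY PLAQUETTE, WITH ITS SCALE** (def-Y's `bg9KP`, threshold `c ≤ 10`, `M·α₀ ≥ 0`, `N ≥ 1`): with `K := 10·L·(M·α₀)`,
`‖U(∂p) − 1‖ ≤ 2K(1+K)e^{4K}·L²·(L^{lev p₀})⁻²` for EVERY plaquette `p` — the covering cube of `exists_cubeClassP_plaquette` has index `lev p₀` or `lev p₀ − 1`
(whence `L²`), and `norm_holY_sub_one_le_of_reg335Cube` reads `2C(1+C)e^{4C}·(η∕(L^{j′}η))²` off it; `C ≤ K`.  Print's (3.69) «O(1)Mα₀(Lʲη)⁻²», in lattice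
units, for `b ∈ Ω_j`, with NO coverage hypothesis. [cite: Balaban1985BackgroundPropagators, (3.69) p.404, (3.35) p.396; Balaban1984PropagatorsII, (2.2) p.224] -/
theorem plaquetteDefect_of_reg335P [Nonempty (Fin N)] {G : Subgroup (Matrix (Fin N) (Fin N) ℂ)ˣ} (U : CfgY (Matrix (Fin N) (Fin N) ℂ) i)
    {c α₀ : ℝ} (hc : c ≤ 10) (hMα : 0 ≤ (kGeo i).M * α₀) (h : (bg9KP (Matrix (Fin N) (Fin N) ℂ) G i).Reg335 c α₀ U) (p : PlaqY i) :
    ‖((holY i U p : (Matrix (Fin N) (Fin N) ℂ)ˣ) : Matrix (Fin N) (Fin N) ℂ) - 1‖ ≤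
      (2 * (10 * (kGeo i).L * ((kGeo i).M * α₀)) * (1 + 10 * (kGeo i).L * ((kGeo i).M * α₀)) * Real.exp (4 * (10 * (kGeo i).L * ((kGeo i).M * α₀)))
        * ((ℓ : ℝ) + 1) ^ 2) * ((((ℓ : ℝ) + 1) ^ levY i (chartY i p.src))⁻¹) ^ 2 := by
  obtain ⟨q, hq, ⟨hx, hxμ, hxν, -⟩, hlev, hn⟩ := exists_cubeClassP_plaquette i hc p.src p.μ p.ν
  have hcube := reg335CubeP_of_reg335P (𝔸 := Matrix (Fin N) (Fin N) ℂ) (G := G) i h hq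
  have hη := eta_pos i
  have hL1 := one_le_L i
  have hLq : (1 : ℝ) ≤ (kGeo i).L ^ q.2.1 := one_le_pow₀ hL1
  have hj : (kGeo i).eta ≤ LatticeNorms.scaleLen (kGeo i).L (kGeo i).eta q.2.1 := by
    unfold LatticeNorms.scaleLen; nlinarith
  have hC0 : 0 ≤ (q.2.2 : ℝ) * ((kGeo i).M * α₀) := mul_nonneg (Nat.cast_nonneg _) hMα
  have key := norm_holY_sub_one_le_of_reg335Cube i U hη hj hC0 hcube p hx hxμ hxν
  have hratio : (kGeo i).eta / LatticeNorms.scaleLen (kGeo i).L (kGeo i).eta q.2.1 = ((kGeo i).L ^ q.2.1)⁻¹ := by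
    unfold LatticeNorms.scaleLen
    rw [div_mul_eq_div_div_swap, div_self hη.ne', one_div]
  rw [hratio] at key
  -- the constant: `C = n·(Mα₀) ≤ 10L·(Mα₀) = K`
  have hnL : (q.2.2 : ℝ) ≤ 10 * (kGeo i).L := by
    show (q.2.2 : ℝ) ≤ 10 * ((ℓ + 1 : ℕ) : ℝ)
    exact_mod_cast hn
  have hCC : (q.2.2 : ℝ) * ((kGeo i).M * α₀) ≤ 10 * (kGeo i).L * ((kGeo i).M * α₀) := mul_le_mul_of_nonneg_right hnL hMα
  have hmono := plaqBound_mono hC0 hCC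
  -- the scale: index `lev` or `lev − 1` ⇒ `(L^{j′})⁻² ≤ L²·(L^{lev})⁻²`
  have hLcast : (kGeo i).L = (ℓ : ℝ) + 1 := by show (((ℓ + 1 : ℕ) : ℝ)) = (ℓ : ℝ) + 1; push_cast; ring
  have hL1' : (1 : ℝ) ≤ (ℓ : ℝ) + 1 := by rw [← hLcast]; exact hL1
  have hle : levV1 i p.src ≤ q.2.1 + 1 := by rcases hlev with h1 | h1 <;> omega
  have hscale : (((kGeo i).L ^ q.2.1)⁻¹) ^ 2 ≤ ((ℓ : ℝ) + 1) ^ 2 * ((((ℓ : ℝ) + 1) ^ levY i (chartY i p.src))⁻¹) ^ 2 := by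
    rw [hLcast, levY_chartY]
    exact inv_pow_sq_le_of_le_succ hL1' hle
  have hK0 : 0 ≤ 2 * (10 * (kGeo i).L * ((kGeo i).M * α₀)) * (1 + 10 * (kGeo i).L * ((kGeo i).M * α₀))
      * Real.exp (4 * (10 * (kGeo i).L * ((kGeo i).M * α₀))) := by
    have : 0 ≤ 10 * (kGeo i).L * ((kGeo i).M * α₀) := by
      have : (0 : ℝ) ≤ (kGeo i).L := le_trans zero_le_one hL1
      positivity
    have := Real.exp_pos (4 * (10 * (kGeo i).L * ((kGeo i).M * α₀)))
    positivity
  calc _ ≤ 2 * ((q.2.2 : ℝ) * ((kGeo i).M * α₀)) * (1 + (q.2.2 : ℝ) * ((kGeo i).M * α₀)) * Real.exp (4 * ((q.2.2 : ℝ) * ((kGeo i).M * α₀))) *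
        (((kGeo i).L ^ q.2.1)⁻¹) ^ 2 := key
    _ ≤ 2 * (10 * (kGeo i).L * ((kGeo i).M * α₀)) * (1 + 10 * (kGeo i).L * ((kGeo i).M * α₀)) * Real.exp (4 * (10 * (kGeo i).L * ((kGeo i).M * α₀))) *
        (((kGeo i).L ^ q.2.1)⁻¹) ^ 2 := mul_le_mul_of_nonneg_right hmono (by positivity)
    _ ≤ 2 * (10 * (kGeo i).L * ((kGeo i).M * α₀)) * (1 + 10 * (kGeo i).L * ((kGeo i).M * α₀)) * Real.exp (4 * (10 * (kGeo i).L * ((kGeo i).M * α₀))) *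
        (((ℓ : ℝ) + 1) ^ 2 * ((((ℓ : ℝ) + 1) ^ levY i (chartY i p.src))⁻¹) ^ 2) := mul_le_mul_of_nonneg_left hscale hK0
    _ = _ := by ring

end Reg335

end Literature.MathematicalPhysics.QuantumFieldTheory.Balaban1983to89.B9Thm310CommutatorDataOfPlaquettes

end
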